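import Mathlib
import Summits.MatrixMultiplication.MatrixMultiplication.Theses.SnSubsetDichotomy

/-!
# Sketch — crux-ideate stmt-MatrixMultiplication-8303 (GlobalBranch), ideator 3, generation 2, round 1

First lemmas of the card `coset-scheme-host-ladder` (the HOST-RUNG LADDER of GlobalBranch:
3 / 2 / 1 / 0 of the three sets are full cosets of a bump-neutral host such as a matching
centraliser `B(M) = C(μ) ≅ S₂ ≀ S_{n/2}`).

PROVED here (sorry-free, standard axioms): the exact reductions of the 2-full and 1-full rungs and
the two counting facts the card uses —
* `hostOneReduction_holds`         : `TPP(H,T,U) ↔ ∀ t t' u u', t t'⁻¹ (u u'⁻¹) ∈ H → t = t' ∧ u = u'`;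
* `twoFullHostsReduction_holds`    : `TPP(H₁,H₂,U) ↔ (U ≠ ∅ → H₁ ⊓ H₂ = ⊥) ∧ Q(U)∖1 avoids the BAD SET H₂H₁`;
* `twoFullHostsSubgroupBound_holds`: a subgroup `L` inside the bad set forces `|U|·|L| ≤ |G|`;
* `subgroupProductPigeonhole_holds`: `|H|·|K| ≤ |G|·|H ⊓ K|` (two conjugate `B_m ≤ S_{2m}` meet in
                                      `≥ |B_m|²/n! ≈ 1.25√n` elements).
STATED only (they elaborate): `HostOneTransporterForm` (the union/transporter form in the coset
scheme), the rung targets `TwoFullHyperoctahedral`, `HostOneHyperoctahedral` (the bets), and the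
crux vocabulary `BumpFree` (verbatim the inner hypothesis of `GlobalBranch`).
-/

set_option linter.dupNamespace false

namespace Summit.MatrixMultiplication.MatrixMultiplication.Cruxes.GlobalBranch.SketchIdeator3G2

open Finset
open scoped Pointwise
open Literature.Combinatorics.Additive

/-! ## Vocabulary -/

/-- Bump-freeness of one set at slack `ε` (verbatim the inner hypothesis of `GlobalBranch`). -/
def BumpFree {n : ℕ} (ε : ℝ) (X : Finset (Equiv.Perm (Fin n))) : Prop :=
  ∀ t : ℕ, 1 ≤ t → (t : ℝ) ≤ Real.sqrt (n : ℝ) → ∀ I L : Fin t → Fin n, Function.Injective I →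
    Function.Injective L →
      ((X.filter (fun σ => ∀ k, σ (I k) = L k)).card : ℝ) * (n.descFactorial t : ℝ) ≤
        (n : ℝ) ^ ((1 / 2 + ε) * t) * (X.card : ℝ)

/-- Right quotient set `Q(X) = {x x'⁻¹}` (the tree's convention in `TripleProductProperty`). -/
def quot {G : Type*} [Group G] [DecidableEq G] (X : Finset G) : Finset G :=
  (X ×ˢ X).image (fun p => p.1 * p.2⁻¹)

/-- Off-diagonal right quotients `{x x'⁻¹ : x ≠ x'}`. -/
def quotOff {G : Type*} [Group G] [DecidableEq G] (X : Finset G) : Finset G :=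
  ((X ×ˢ X).filter (fun p => p.1 ≠ p.2)).image (fun p => p.1 * p.2⁻¹)

/-! ## The full host as a finset, and the proved reductions -/

noncomputable def hostSet {G : Type*} [Group G] [Fintype G] (H : Subgroup G) : Finset G := by
  classical exact univ.filter (· ∈ H)

theorem mem_hostSet {G : Type*} [Group G] [Fintype G] (H : Subgroup G) (x : G) :
    x ∈ hostSet H ↔ x ∈ H := by
  classical
  unfold hostSet
  simp

def HostOneReduction : Prop :=
  ∀ (G : Type) [Group G] [Fintype G] [DecidableEq G] (H : Subgroup G) (T U : Finset G),
    TripleProductProperty (hostSet H) T U ↔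
      ∀ t ∈ T, ∀ t' ∈ T, ∀ u ∈ U, ∀ u' ∈ U, t * t'⁻¹ * (u * u'⁻¹) ∈ H → t = t' ∧ u = u'

theorem hostOneReduction_holds : HostOneReduction := by
  intro G _ _ _ H T U
  constructor
  · intro hTPP t ht t' ht' u hu u' hu' hw
    have h1 : (1 : G) ∈ hostSet H := (mem_hostSet H 1).2 H.one_mem
    have hs : (t * t'⁻¹ * (u * u'⁻¹))⁻¹ ∈ hostSet H := (mem_hostSet H _).2 (H.inv_mem hw)
    have key := hTPP _ hs _ h1 t ht t' ht' u hu u' hu' (by group)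
    exact ⟨key.2.1, key.2.2⟩
  · intro h s hs s' hs' t ht t' ht' u hu u' hu' heq
    have hsH : s ∈ H := (mem_hostSet H s).1 hs
    have hs'H : s' ∈ H := (mem_hostSet H s').1 hs'
    have h2 : s * s'⁻¹ * (t * t'⁻¹ * (u * u'⁻¹)) = 1 := by simpa [mul_assoc] using heq
    have h3 : t * t'⁻¹ * (u * u'⁻¹) * (s * s'⁻¹) = 1 := mul_eq_one_comm.mp h2
    have hw : t * t'⁻¹ * (u * u'⁻¹) ∈ H := by
      have : t * t'⁻¹ * (u * u'⁻¹) = (s * s'⁻¹)⁻¹ := eq_inv_of_mul_eq_one_left h3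
      rw [this]
      exact H.inv_mem (H.mul_mem hsH (H.inv_mem hs'H))
    obtain ⟨rfl, rfl⟩ := h t ht t' ht' u hu u' hu' hw
    refine ⟨?_, rfl, rfl⟩
    have : s * s'⁻¹ = 1 := by simpa using heq
    exact mul_inv_eq_one.mp this

def TwoFullHostsReduction : Prop :=
  ∀ (G : Type) [Group G] [Fintype G] [DecidableEq G] (H₁ H₂ : Subgroup G) (U : Finset G),
    TripleProductProperty (hostSet H₁) (hostSet H₂) U ↔
      ((U.Nonempty → H₁ ⊓ H₂ = ⊥) ∧
        ∀ u ∈ U, ∀ u' ∈ U, u ≠ u' → u * u'⁻¹ ∉ (hostSet H₂ * hostSet H₁ : Finset G))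

theorem twoFullHostsReduction_holds : TwoFullHostsReduction := by
  intro G _ _ _ H₁ H₂ U
  constructor
  · intro hTPP
    refine ⟨?_, ?_⟩
    · rintro ⟨u, hu⟩
      rw [Subgroup.eq_bot_iff_forall]
      intro h hh
      have hh1 : h ∈ H₁ := (Subgroup.mem_inf.1 hh).1
      have hh2 : h ∈ H₂ := (Subgroup.mem_inf.1 hh).2
      have key := hTPP h ((mem_hostSet H₁ h).2 hh1) 1 ((mem_hostSet H₁ 1).2 H₁.one_mem)
        h⁻¹ ((mem_hostSet H₂ _).2 (H₂.inv_mem hh2)) 1 ((mem_hostSet H₂ 1).2 H₂.one_mem)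
        u hu u hu (by group)
      simpa using key.1
    · intro u hu u' hu' hne hmem
      obtain ⟨a, ha, b, hb, hab⟩ := Finset.mem_mul.1 hmem
      have haH : a ∈ H₂ := (mem_hostSet H₂ a).1 ha
      have hbH : b ∈ H₁ := (mem_hostSet H₁ b).1 hb
      have key := hTPP b⁻¹ ((mem_hostSet H₁ _).2 (H₁.inv_mem hbH)) 1
        ((mem_hostSet H₁ 1).2 H₁.one_mem) a⁻¹ ((mem_hostSet H₂ _).2 (H₂.inv_mem haH)) 1
        ((mem_hostSet H₂ 1).2 H₂.one_mem) u hu u' hu' (by rw [← hab]; group)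
      exact hne key.2.2
  · rintro ⟨hbot, havoid⟩ s hs s' hs' t ht t' ht' u hu u' hu' heq
    have hsH : s ∈ H₁ := (mem_hostSet H₁ s).1 hs
    have hs'H : s' ∈ H₁ := (mem_hostSet H₁ s').1 hs'
    have htH : t ∈ H₂ := (mem_hostSet H₂ t).1 ht
    have ht'H : t' ∈ H₂ := (mem_hostSet H₂ t').1 ht'
    -- u u'⁻¹ = (t t'⁻¹)⁻¹ (s s'⁻¹)⁻¹ ∈ H₂ H₁
    have h2 : s * s'⁻¹ * (t * t'⁻¹) * (u * u'⁻¹) = 1 := heq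
    have huu : u * u'⁻¹ = (t * t'⁻¹)⁻¹ * (s * s'⁻¹)⁻¹ := by
      have h3 : (s * s'⁻¹ * (t * t'⁻¹)) * (u * u'⁻¹) = 1 := by simpa [mul_assoc] using h2
      have h4 : u * u'⁻¹ = (s * s'⁻¹ * (t * t'⁻¹))⁻¹ := eq_inv_of_mul_eq_one_right h3
      rw [h4, mul_inv_rev]
    have hmem : u * u'⁻¹ ∈ (hostSet H₂ * hostSet H₁ : Finset G) := by
      rw [huu]
      exact Finset.mul_mem_mul ((mem_hostSet H₂ _).2 (H₂.inv_mem (H₂.mul_mem htH (H₂.inv_mem ht'H))))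
        ((mem_hostSet H₁ _).2 (H₁.inv_mem (H₁.mul_mem hsH (H₁.inv_mem hs'H))))
    have huu' : u = u' := by
      by_contra hne
      exact havoid u hu u' hu' hne hmem
    subst huu'
    have hprod : s * s'⁻¹ * (t * t'⁻¹) = 1 := by simpa using h2
    -- s s'⁻¹ = (t t'⁻¹)⁻¹ lies in H₁ ⊓ H₂ = ⊥
    have hb := hbot ⟨u, hu⟩
    have h5 : s * s'⁻¹ = (t * t'⁻¹)⁻¹ := eq_inv_of_mul_eq_one_left hprod
    have hin : s * s'⁻¹ ∈ H₁ ⊓ H₂ := by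
      refine Subgroup.mem_inf.2 ⟨H₁.mul_mem hsH (H₁.inv_mem hs'H), ?_⟩
      rw [h5]; exact H₂.inv_mem (H₂.mul_mem htH (H₂.inv_mem ht'H))
    rw [hb, Subgroup.mem_bot] at hin
    have hss : s = s' := mul_inv_eq_one.mp hin
    refine ⟨hss, ?_, rfl⟩
    rw [hin] at h5
    have : t * t'⁻¹ = 1 := by
      have := h5.symm
      rwa [inv_eq_one] at this
    exact mul_inv_eq_one.mp this

def TwoFullHostsSubgroupBound : Prop :=
  ∀ (G : Type) [Group G] [Fintype G] [DecidableEq G] (H₁ H₂ L : Subgroup G) (U : Finset G),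
    TripleProductProperty (hostSet H₁) (hostSet H₂) U →
      (hostSet L ⊆ (hostSet H₂ * hostSet H₁ : Finset G)) →
        U.card * Nat.card L ≤ Fintype.card G

theorem twoFullHostsSubgroupBound_holds : TwoFullHostsSubgroupBound := by
  intro G _ _ _ H₁ H₂ L U hTPP hL
  have havoid := ((twoFullHostsReduction_holds G H₁ H₂ U).1 hTPP).2
  -- the right translates (hostSet L)·u, u ∈ U, are pairwise disjoint
  have hcardL : (hostSet L).card = Nat.card L := by
    classical
    rw [Nat.card_eq_fintype_card, ← Fintype.card_coe]
    refine Fintype.card_congr (Equiv.subtypeEquiv (Equiv.refl G) (fun x => ?_))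
    simp [mem_hostSet]
  have hdisj : (U : Set G).PairwiseDisjoint (fun u => (hostSet L).image (· * u)) := by
    intro u hu u' hu' hne
    rw [Function.onFun, Finset.disjoint_left]
    intro x hx hx'
    obtain ⟨l, hl, rfl⟩ := Finset.mem_image.1 hx
    obtain ⟨l', hl', hll⟩ := Finset.mem_image.1 hx'
    have hlL : l ∈ L := (mem_hostSet L l).1 hl
    have hl'L : l' ∈ L := (mem_hostSet L l').1 hl'
    -- l' * u' = l * u  ⇒  u * u'⁻¹ = l⁻¹ * l' ∈ L ⊆ bad
    have hq : u * u'⁻¹ = l⁻¹ * l' := by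
      have : l * u = l' * u' := hll.symm
      calc u * u'⁻¹ = l⁻¹ * (l * u) * u'⁻¹ := by group
        _ = l⁻¹ * (l' * u') * u'⁻¹ := by rw [this]
        _ = l⁻¹ * l' := by group
    have hmem : u * u'⁻¹ ∈ (hostSet H₂ * hostSet H₁ : Finset G) := by
      apply hL
      rw [hq]
      exact (mem_hostSet L _).2 (L.mul_mem (L.inv_mem hlL) hl'L)
    exact havoid u (by exact_mod_cast hu) u' (by exact_mod_cast hu') hne hmem
  have hcard_img : ∀ u ∈ U, ((hostSet L).image (· * u)).card = Nat.card L := by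
    intro u _
    rw [Finset.card_image_of_injective _ (mul_left_injective u), hcardL]
  calc U.card * Nat.card L = ∑ u ∈ U, ((hostSet L).image (· * u)).card := by
        rw [Finset.sum_const_nat hcard_img, mul_comm]
    _ = (U.biUnion (fun u => (hostSet L).image (· * u))).card := (Finset.card_biUnion hdisj).symm
    _ ≤ Fintype.card G := Finset.card_le_univ _

def subgroupProductPigeonhole : Prop :=
  ∀ (G : Type) [Group G] [Fintype G] (H K : Subgroup G),
    Nat.card H * Nat.card K ≤ Fintype.card G * Nat.card ↥(H ⊓ K)

theorem subgroupProductPigeonhole_holds : subgroupProductPigeonhole := by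
  intro G _ _ H K
  have hidx : (H ⊓ K).index ≤ H.index * K.index := Subgroup.index_inf_le
  have hH := H.card_mul_index
  have hK := K.card_mul_index
  have hHK := (H ⊓ K).card_mul_index
  have hG : Nat.card G = Fintype.card G := Nat.card_eq_fintype_card
  have hpos : 0 < (H ⊓ K).index := Nat.pos_of_ne_zero Subgroup.index_ne_zero_of_finite
  -- |H||K| (H⊓K).index ≤ |H||K| H.index K.index = |G|^2 = |G| |H⊓K| (H⊓K).index
  have key : Nat.card H * Nat.card K * (H ⊓ K).index ≤ Fintype.card G * Nat.card ↥(H ⊓ K) * (H ⊓ K).index := by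
    calc Nat.card H * Nat.card K * (H ⊓ K).index ≤ Nat.card H * Nat.card K * (H.index * K.index) :=
          Nat.mul_le_mul_left _ hidx
      _ = (Nat.card H * H.index) * (Nat.card K * K.index) := by ring
      _ = Nat.card G * Nat.card G := by rw [hH, hK]
      _ = Nat.card G * (Nat.card ↥(H ⊓ K) * (H ⊓ K).index) := by rw [hHK]
      _ = Fintype.card G * Nat.card ↥(H ⊓ K) * (H ⊓ K).index := by rw [hG]; ring
  exact Nat.le_of_mul_le_mul_right key hpos


/-! ## Rung 1, transporter form (statement) -/

/-- ONE FULL HOST, TRANSPORTER FORM. `TPP(H,T,U)` iff (`U ≠ ∅ →` `T` is a partial transversal of the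
right cosets `Ht`) and the off-diagonal quotients of `U` avoid the `H`-SATURATION `Q(T)·H`. In the
coset space `Ω = G/H` (`gH ↔ g·M₀` when `H = Stab(M₀)`): `u(M_{u'}) ∉ ⋃_{t∈T} t(E_T)` for `u ≠ u'`,
`E_T = {t⁻¹M₀ : t ∈ T}` — the `T`-union of `E_T` and the `U`-union of `E_U ∖ {M_u}` are DISJOINT,
so `T ⊆ 𝒮(E_T → A')` is contained in the TRANSPORTER of `E_T` into `A' = ⋃_t t(E_T)`. -/
def HostOneTransporterForm : Prop :=
  ∀ (G : Type) [Group G] [Fintype G] [DecidableEq G] (H : Subgroup G) (T U : Finset G),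
    TripleProductProperty (hostSet H) T U ↔
      ((U.Nonempty → ∀ t ∈ T, ∀ t' ∈ T, t * t'⁻¹ ∈ H → t = t') ∧
        Disjoint (quotOff U) (quot T * hostSet H))

/-! ## Rung targets for hyperoctahedral hosts (the bets) -/

/-- A fixed-point-free involution = a perfect matching `M`; `B(M) = C(μ) ≅ S₂ ≀ S_{n/2}`. -/
def IsMatching {n : ℕ} (μ : Equiv.Perm (Fin n)) : Prop := μ * μ = 1 ∧ ∀ x, μ x ≠ x

/-- The full hyperoctahedral host `B(M) = C(μ)` as a finset. -/
noncomputable def hostB {n : ℕ} (μ : Equiv.Perm (Fin n)) : Finset (Equiv.Perm (Fin n)) := by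
  classical exact univ.filter (fun σ => σ * μ = μ * σ)

/-- RUNG-2 TARGET (bet): two full ROOTED matching centralisers and any subset of a third never
reach `(n!)^{3/2}e^{-c√n}`; by `TwoFullHostsReduction` a statement about independent sets of
`Cay(B(M₃), Z)`, `Z = B(M₃) ∩ K₂K₁` (computed: `|Z ∩ K₃|/|K₃| = 0.385, 0.328` at `n = 10, 14`,
`⟨Z ∩ K₃⟩ = K₃`, greedy independent sets of size 8, 16 — kit j012415). -/
def TwoFullHyperoctahedral : Prop :=
  ∃ c : ℝ, 0 < c ∧ ∃ n₀ : ℕ, ∀ n ≥ n₀, ∀ μ₁ μ₂ μ₃ : Equiv.Perm (Fin n),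
    IsMatching μ₁ → IsMatching μ₂ → IsMatching μ₃ →
      ∀ S T U : Finset (Equiv.Perm (Fin n)), U ⊆ hostB μ₃ →
        (∃ a, S = (hostB μ₁).filter (fun σ => σ a = a)) →
        (∃ b, T = (hostB μ₂).filter (fun σ => σ b = b)) →
          TripleProductProperty S T U →
            ((S.card * T.card * U.card : ℕ) : ℝ) ≤
              (n.factorial : ℝ) ^ ((3 : ℝ) / 2) * Real.exp (-(c * Real.sqrt (n : ℝ)))

/-- RUNG-1 TARGET (bet): one full (or rooted) matching centraliser and two BUMP-FREE sets. -/
def HostOneHyperoctahedral : Prop :=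
  ∃ ε : ℝ, 0 < ε ∧ ∃ c : ℝ, 0 < c ∧ ∃ n₀ : ℕ, ∀ n ≥ n₀, ∀ μ : Equiv.Perm (Fin n), IsMatching μ →
    ∀ S T U : Finset (Equiv.Perm (Fin n)),
      (S = hostB μ ∨ ∃ a, S = (hostB μ).filter (fun σ => σ a = a)) →
        BumpFree ε T → BumpFree ε U → TripleProductProperty S T U →
          ((S.card * T.card * U.card : ℕ) : ℝ) ≤
            (n.factorial : ℝ) ^ ((3 : ℝ) / 2) * Real.exp (-(c * Real.sqrt (n : ℝ)))

/-- The crux itself is the rung-0 statement. -/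
example : Prop := Summit.MatrixMultiplication.MatrixMultiplication.Theses.SnSubsetDichotomy.GlobalBranch

end Summit.MatrixMultiplication.MatrixMultiplication.Cruxes.GlobalBranch.SketchIdeator3G2
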